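import Literature.IUT.LogThetaLattice.GlobalKummerNonInterferenceRemark3101ModelGlobal
import Literature.IUT.LogThetaLattice.GlobalKummerNonInterferenceProofs
import Literature.IUT.LogThetaLattice.GlobalFrobenioidModelsLogVolume
import HarnessLib

/-!
# [IUTchIII] Remark 3.10.1 (ii)/(iii): kernel decisions for the FACT rows F-2094, F-2096, F-2097

S. Mochizuki, *Inter-universal Teichmüller theory III*, kurims manuscript (May 2020) of PRIMS **57** (2021),
§3, Remark 3.10.1 (ii), p. 150: "the mutual compatibility of the isomorphisms
`^{n,m}𝔉^{⊩⊥}_LGP ≅ 𝔉^{⊩⊥}(^{n,∘}𝓗𝓣^{𝒟-Θ±ell NF})_LGP` of the second display of Proposition 3.10, (iii), asserts, in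
effect, that such Kummer-detachment indeterminacies do not arise. This is precisely the reason why we wish
to work with the LGP-, as opposed to the lgp-, Gaussian log-theta lattice"; (iii), p. 150: "one may
nevertheless compute — i.e., if one takes into account the various distortions that occur, 'estimate' — the
global arithmetic degrees of objects of '`𝓕⊛_𝔪𝔬𝔡`' by computing log-volumes … which are bi-coric".
[cite: Mochizuki2012, IUTchIII Rmk 3.10.1 (ii)(iii) p.150] [claim: Mochizuki2012, status: disputed] (D-0012
claim key; the mathematics below is elementary transport of bijections along `ℤ` plus number-field
bookkeeping already landed).

PROOF-ONLY companion (0 definitions, nothing restated) of abc-iut-L6-t4's `GlobalKummerNonInterference.lean`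
(p404134/p407875) for the abc-iut FACT-LIST rows of D-0079 L-F sub-cell F6 (abc-iut-L6-t6 g9), consuming BY
NAME the landed closers of the w5-d231 / w4-d097 / w4-d009 / w4-d002 lineages
(`GlobalKummerNonInterferenceCompatibleFamilies` p408636, `…Proofs` p405475, `…Remark3101Model*`
p432249/p432866/p433409, `GlobalFrobenioidModelsLogVolume` p410376, `GlobalFrobenioidModelsTransport`).

**F-2096 `Remark3101ii_noKummerDetachmentIndeterminacy`** (typed: ANY two log-link-compatible Kummer
families are EQUAL; universal closure refuted, `not_Remark3101ii_of_nontrivial_perm` p405475).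
* §1 EXACT KERNEL CHARACTERISATION — `Remark3101ii_noKummerDetachmentIndeterminacy_iff`: the typed predicate
  holds IFF it holds for a degenerate reason: no compatible family exists at all
  (`Remark3101i_noCompatibleIso`) OR the coric object is a subsingleton; explicit form `…_iff_explicit`
  (some log-link map non-bijective ∨ `Ffrob 0 ≄ C` ∨ `C` subsingleton).
* §1 PRINT-FAITHFUL GUARDED RE-TYPE, PROVED FOR ALL DATA — `kummer_eq_of_compatible_of_eq_at`: two compatible
  Kummer families that agree at ONE index agree everywhere (uniqueness modulo the "identity indeterminacy"
  of Prop. 3.10 (ii), "up to [harmless!] 'identity indeterminacies' at an adjacent 'm'", p. 149); torsor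
  form `existsUnique_perm_of_compatible`: any two compatible families differ by EXACTLY ONE permutation of
  the coric object, constant along the column — the residual Kummer-detachment indeterminacy is a single
  global relabelling, none "arises" along the log-links.
* §3 AT THE GENUINE NUMBER-FIELD CARRIERS the typed (unguarded) predicate is INVERTED with respect to print:
  it FAILS on the `MOD`/LGP column of model global Frobenioids (`not_remark3101ii_noKDI_MOD`: a compatible
  family exists by `prop310iii_model` and the coric object has two distinct objects) and HOLDS on the
  `𝔪𝔬𝔡`/lgp column (`remark3101ii_noKDI_frakFamily`: vacuously, no compatible family) — whereas print locates
  "Kummer-detachment indeterminacies do not arise" on the LGP side. Kernel confirmation that the row is a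
  mis-typing; its content is carried by F-2094 and §1.

**F-2094 `Remark3101ii_contrast`** (conditional on `G := Remark3101ii_contrast_of`, w5-d231 p408636): `G`'s
hypotheses are DISCHARGED at the genuine carriers by `remark3101ii_contrast_frakFamily` (p433409; both columns
over the number field `F = F_mod`), local twins p432249/p432866. NEW kernel anchor §3
`remark3101ii_MOD_kummer_torsor`: on the `MOD` column every log-link-compatible Kummer family IS the functorial
one `frakTransport (κ m)` followed by ONE permutation of the coric object — existence (Prop. 3.10 (iii)) plus
uniqueness up to the identity indeterminacy, i.e. the (ii) sentence at the model.

**F-2097 `Remark3101iii_estimate`** (model-witness `remark3101iii_estimate_frak`, w4-d009 p410376). §2: the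
universal closure is REFUTED (`not_forall_Remark3101iii_estimate`: free `deg := 1`, `vol := 0`); the schema
is CHARACTERISED (`Remark3101iii_estimate_iff_of_refl_mono`: for a reflexive containment and a monotone
volume it says exactly `deg ≤ vol ∘ regionOf`; `…_of_vol_regionOf_eq`: it follows from Prop. 3.9 (iii)'s
"log-volume = degree" plus monotonicity). §3: the instance of record lives on the GENUINE carrier (objects
`𝔍 = {𝔍_v}` of `𝓕⊛_𝔪𝔬𝔡` over ALL places of a number field, Ex. 3.6 (ii); `deg` = degree of the arithmetic
divisor of `𝔍`; `vol` = abc-iut-L6-d3's divisor log-volume of Prop. 3.9 (iii)) and is SHARP there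
(`remark3101iii_estimate_frak_sharp`: the bound is attained at `𝔍`'s own region) — an upgrade from
"model-witness" to "proved at the genuine instance, schema refuted".

HONEST FRAMING: deciding a FACT row = OUR kernel theorem / refutation of OUR typed statement; nothing here
adjudicates print, asserts abc proved or refuted, or takes a side on [IUTchIII] Cor. 3.12; typed ≠ proved
elsewhere.
-/

noncomputable section

namespace Literature.IUT.LogThetaLattice

open GlobalFrobenioidModels

universe u v w

/-! ### §1 F-2096 — the typed "no Kummer-detachment indeterminacy", characterised and re-typed -/

section NoKDI

variable {C : Type u} {Ffrob : ℤ → Type u} {lg : ∀ m, Ffrob m → Ffrob (m + 1)}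

/-- Index transport for pointwise equality of Kummer families (bookkeeping).
[cite: Mochizuki2012, IUTchIII Rmk 3.10.1 (ii) p.150] [claim: Mochizuki2012, status: disputed] -/
private theorem kum_eq_at_congr {kum kum' : ∀ m, Ffrob m ≃ C} {a b : ℤ} (hab : a = b) :
    kum a = kum' a ↔ kum b = kum' b := by
  subst hab
  exact Iff.rfl

/-- **F-2096, PRINT-FAITHFUL GUARDED RE-TYPE of [IUTchIII] Rmk. 3.10.1 (ii)** ("such Kummer-detachment
indeterminacies do not arise", p. 150, read modulo the "[harmless!] 'identity indeterminacies'" of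
Prop. 3.10 (ii), p. 149): two log-link-compatible families of Kummer identifications that AGREE AT ONE INDEX
`m₀` agree at EVERY index — PROVED for all data (downward by `kummer_eq_of_eq_succ`, upward by
`kummer_eq_succ_of_eq`, the log-link maps being forced bijective by `lg_bijective_of_compatible`).
[cite: Mochizuki2012, IUTchIII Rmk 3.10.1 (ii) p.150] [claim: Mochizuki2012, status: disputed] -/
theorem kummer_eq_of_compatible_of_eq_at {kum kum' : ∀ m, Ffrob m ≃ C}
    (hk : Prop310iii_compatible Ffrob kum lg) (hk' : Prop310iii_compatible Ffrob kum' lg) (m₀ : ℤ)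
    (h0 : kum m₀ = kum' m₀) : kum = kum' := by
  funext m
  refine Int.inductionOn' (motive := fun m => kum m = kum' m) m m₀ h0 (fun k _ ih => ?_) fun k _ ih => ?_
  · exact kummer_eq_succ_of_eq (fun m => (lg_bijective_of_compatible hk m).2) hk hk' k ih
  · exact kummer_eq_of_eq_succ hk hk' (k - 1) ((kum_eq_at_congr (sub_add_cancel k 1)).mpr ih)

/-- **F-2096, TORSOR FORM** ([IUTchIII] Rmk. 3.10.1 (ii), p. 150; Prop. 3.10 (ii) "identity indeterminacies",
p. 149): any two log-link-compatible Kummer families differ by EXACTLY ONE permutation `σ` of the coric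
object, the SAME at every index: `kum' m = kum m ≫ σ`. The Kummer-detachment indeterminacy of a compatible
column is one global relabelling of the coric object; no indeterminacy "arises" along the log-links — PROVED
for all data. [cite: Mochizuki2012, IUTchIII Rmk 3.10.1 (ii) p.150] [claim: Mochizuki2012, status: disputed] -/
theorem existsUnique_perm_of_compatible {kum kum' : ∀ m, Ffrob m ≃ C}
    (hk : Prop310iii_compatible Ffrob kum lg) (hk' : Prop310iii_compatible Ffrob kum' lg) :
    ∃! σ : Equiv.Perm C, ∀ m, kum' m = (kum m).trans σ := by
  refine ⟨(kum 0).symm.trans (kum' 0), fun m => ?_, fun τ hτ => ?_⟩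
  · have hσ : Prop310iii_compatible Ffrob (fun m => (kum m).trans ((kum 0).symm.trans (kum' 0))) lg :=
      fun m x => by simp only [Equiv.trans_apply, hk m x]
    have h0 : (fun m => (kum m).trans ((kum 0).symm.trans (kum' 0))) 0 = kum' 0 := by
      ext x
      simp
    exact (congrFun (kummer_eq_of_compatible_of_eq_at hσ hk' 0 h0) m).symm
  · ext c
    change τ c = kum' 0 ((kum 0).symm c)
    rw [hτ 0, Equiv.trans_apply, Equiv.apply_symm_apply]

/-- The typed predicate holds when the coric object is a SUBSINGLETON (degenerate reason 1).
[cite: Mochizuki2012, IUTchIII Rmk 3.10.1 (ii) p.150] [claim: Mochizuki2012, status: disputed] -/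
theorem Remark3101ii_noKummerDetachmentIndeterminacy_of_subsingleton [Subsingleton C] :
    Remark3101ii_noKummerDetachmentIndeterminacy (C := C) Ffrob lg :=
  fun _ _ _ _ => funext fun _ => Equiv.ext fun _ => Subsingleton.elim _ _

/-- The typed predicate holds when NO compatible family exists (degenerate reason 2 — vacuity; this is the
`𝔪𝔬𝔡`-side obstruction `Remark3101i_noCompatibleIso` of Rmk. 3.10.1 (i)).
[cite: Mochizuki2012, IUTchIII Rmk 3.10.1 (i)(ii) p.149–150] [claim: Mochizuki2012, status: disputed] -/
theorem Remark3101ii_noKummerDetachmentIndeterminacy_of_noCompatibleIso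
    (h : Remark3101i_noCompatibleIso (C := C) Ffrob lg) :
    Remark3101ii_noKummerDetachmentIndeterminacy (C := C) Ffrob lg :=
  fun kum _ hk _ => (h ⟨kum, hk⟩).elim

/-- The typed predicate FAILS as soon as one compatible family exists and the coric object has two distinct
elements (swap them: `not_Remark3101ii_of_nontrivial_perm`, p405475).
[cite: Mochizuki2012, IUTchIII Rmk 3.10.1 (ii) p.150] [claim: Mochizuki2012, status: disputed] -/
theorem not_Remark3101ii_noKummerDetachmentIndeterminacy_of_compatible [Nontrivial C]
    {kum : ∀ m, Ffrob m ≃ C} (hk : Prop310iii_compatible Ffrob kum lg) :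
    ¬ Remark3101ii_noKummerDetachmentIndeterminacy (C := C) Ffrob lg := by
  classical
  obtain ⟨a, b, hab⟩ := exists_pair_ne C
  haveI : Nonempty (Ffrob 0) := ⟨(kum 0).symm a⟩
  exact not_Remark3101ii_of_nontrivial_perm Ffrob lg kum hk (Equiv.swap a b)
    (fun h => hab (Equiv.swap_eq_one_iff.mp h))

/-- **F-2096, EXACT KERNEL CHARACTERISATION**: the typed `Remark3101ii_noKummerDetachmentIndeterminacy`
holds IF AND ONLY IF it holds for a degenerate reason — no log-link-compatible Kummer family exists at all,
or the coric object is a subsingleton. (So, as typed, the predicate never expresses the printed content; cf.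
`kummer_eq_of_compatible_of_eq_at` for the guarded form and `Remark3101ii_contrast`, F-2094, for the
contentful reading.) [cite: Mochizuki2012, IUTchIII Rmk 3.10.1 (ii) p.150] [claim: Mochizuki2012, status: disputed] -/
theorem Remark3101ii_noKummerDetachmentIndeterminacy_iff :
    Remark3101ii_noKummerDetachmentIndeterminacy (C := C) Ffrob lg ↔
      Remark3101i_noCompatibleIso (C := C) Ffrob lg ∨ Subsingleton C := by
  constructor
  · intro h
    by_contra hcon
    rw [not_or, Remark3101i_noCompatibleIso, not_not, not_subsingleton_iff_nontrivial] at hcon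
    obtain ⟨⟨kum, hk⟩, _⟩ := hcon
    exact not_Remark3101ii_noKummerDetachmentIndeterminacy_of_compatible hk h
  · rintro (h | h)
    · exact Remark3101ii_noKummerDetachmentIndeterminacy_of_noCompatibleIso h
    · exact Remark3101ii_noKummerDetachmentIndeterminacy_of_subsingleton

/-- **F-2096, explicit form of the characterisation** (with `Remark3101i_noCompatibleIso_iff`, p408636): the
typed predicate holds iff some log-link map is NOT a bijection, or the coric object is NOT in bijection with
the copy at index `0`, or the coric object is a subsingleton.
[cite: Mochizuki2012, IUTchIII Rmk 3.10.1 (ii) p.150] [claim: Mochizuki2012, status: disputed] -/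
theorem Remark3101ii_noKummerDetachmentIndeterminacy_iff_explicit :
    Remark3101ii_noKummerDetachmentIndeterminacy (C := C) Ffrob lg ↔
      (∃ m, ¬ Function.Bijective (lg m)) ∨ IsEmpty (Ffrob 0 ≃ C) ∨ Subsingleton C := by
  rw [Remark3101ii_noKummerDetachmentIndeterminacy_iff, Remark3101i_noCompatibleIso_iff, or_assoc]

/-- Under the CONTRAST of F-2094 the typed F-2096 predicate automatically HOLDS on the `𝔪𝔬𝔡`/lgp column (for
the vacuous reason) — the abstract form of the inversion exhibited at the model in §3.
[cite: Mochizuki2012, IUTchIII Rmk 3.10.1 (ii) p.150] [claim: Mochizuki2012, status: disputed] -/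
theorem Remark3101ii_contrast.noKDI_frak {CMOD Cfrak : Type u} {FMOD Ffrak : ℤ → Type u}
    {lgMOD : ∀ m, FMOD m → FMOD (m + 1)} {lgfrak : ∀ m, Ffrak m → Ffrak (m + 1)}
    (h : Remark3101ii_contrast CMOD Cfrak FMOD Ffrak lgMOD lgfrak) :
    Remark3101ii_noKummerDetachmentIndeterminacy (C := Cfrak) Ffrak lgfrak :=
  Remark3101ii_noKummerDetachmentIndeterminacy_of_noCompatibleIso h.2

/-- Under the CONTRAST of F-2094 the typed F-2096 predicate FAILS on the `MOD`/LGP column as soon as the coric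
object has two distinct elements. [cite: Mochizuki2012, IUTchIII Rmk 3.10.1 (ii) p.150]
[claim: Mochizuki2012, status: disputed] -/
theorem Remark3101ii_contrast.not_noKDI_MOD {CMOD Cfrak : Type u} {FMOD Ffrak : ℤ → Type u}
    {lgMOD : ∀ m, FMOD m → FMOD (m + 1)} {lgfrak : ∀ m, Ffrak m → Ffrak (m + 1)}
    (h : Remark3101ii_contrast CMOD Cfrak FMOD Ffrak lgMOD lgfrak) [Nontrivial CMOD] :
    ¬ Remark3101ii_noKummerDetachmentIndeterminacy (C := CMOD) FMOD lgMOD := by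
  obtain ⟨kum, hk⟩ := h.1
  exact not_Remark3101ii_noKummerDetachmentIndeterminacy_of_compatible hk

end NoKDI

/-! ### §2 F-2097 — the typed ESTIMATE schema, refuted as a closure and characterised -/

section Estimate

/-- **F-2097, the universal closure of the typed schema is FALSE**: with FREE `deg`, `vol` take one object,
one region, `deg := 1`, `vol := 0`. [cite: Mochizuki2012, IUTchIII Rmk 3.10.1 (iii) p.150]
[claim: Mochizuki2012, status: disputed] -/
theorem not_forall_Remark3101iii_estimate :
    ¬ ∀ (Obj R : Type) [HasSubset R] (deg : Obj → ℝ) (regionOf : Obj → R) (vol : R → ℝ),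
        Remark3101iii_estimate deg regionOf vol := by
  intro h
  have h1 : (1 : ℝ) ≤ 0 :=
    @h Unit Unit ⟨fun _ _ => True⟩ (fun _ => 1) id (fun _ => 0) () () trivial
  exact absurd h1 (by norm_num)

variable {Obj R : Type u} [HasSubset R] {deg : Obj → ℝ} {regionOf : Obj → R} {vol : R → ℝ}

/-- **F-2097, CHARACTERISATION**: for a reflexive containment and a MONOTONE volume ("log-volumes … which are
bi-coric" are measures of regions, p. 150) the typed estimate says exactly `deg 𝔍 ≤ vol (region of 𝔍)` for
every object. [cite: Mochizuki2012, IUTchIII Rmk 3.10.1 (iii) p.150] [claim: Mochizuki2012, status: disputed] -/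
theorem Remark3101iii_estimate_iff_of_refl_mono (hrefl : ∀ S : R, S ⊆ S)
    (hmono : ∀ S T : R, S ⊆ T → vol S ≤ vol T) :
    Remark3101iii_estimate deg regionOf vol ↔ ∀ J, deg J ≤ vol (regionOf J) :=
  ⟨fun h J => h J _ (hrefl _), fun h J _ hS => (h J).trans (hmono _ _ hS)⟩

/-- **F-2097 from Prop. 3.9 (iii)**: if the volume is monotone and the log-volume of the region of `𝔍` IS
its degree ("log-volume = degree", Prop. 3.9 (iii) p. 117), the typed estimate holds.
[cite: Mochizuki2012, IUTchIII Rmk 3.10.1 (iii) p.150] [claim: Mochizuki2012, status: disputed] -/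
theorem Remark3101iii_estimate_of_vol_regionOf_eq (hmono : ∀ S T : R, S ⊆ T → vol S ≤ vol T)
    (heq : ∀ J, vol (regionOf J) = deg J) : Remark3101iii_estimate deg regionOf vol :=
  fun J _ hS => (heq J).symm.le.trans (hmono _ _ hS)

end Estimate

/-! ### §3 At the GENUINE number-field carriers -/

section Genuine

/-- Two distinct objects of `𝓕⊛_𝔪𝔬𝔡` / `𝓕⊛_MOD`-type object families: the trivial family and the family with one
nonzero class at `v₀` (Ex. 3.6 (ii) objects `{𝔍_v}`). [cite: Mochizuki2012, IUTchIII Ex 3.6 (ii) p.107]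
[claim: Mochizuki2012, status: disputed] -/
theorem FrakObj.nontrivial_of_ne_zero {V : Type v} {Γ : V → Type w} [∀ v, AddCommGroup (Γ v)] (v₀ : V)
    (g : Γ v₀) (hg : g ≠ 0) : Nontrivial (FrakObj V Γ) := by
  classical
  refine ⟨⟨⟨fun _ => 0, by simp⟩, ⟨Pi.single v₀ g, (Set.finite_singleton v₀).subset fun v hv => ?_⟩, ?_⟩⟩
  · by_contra hne
    exact hv (Pi.single_eq_of_ne hne g)
  · intro h
    have := congrFun (congrArg FrakObj.cls h) v₀
    simp only [Pi.single_eq_same] at this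
    exact hg this.symm

/-- The coric object of the `MOD` column at the model — the objects of the model global Frobenioid over ALL
places of a number field `K` with `Γ_v = ℝ` — has two distinct objects.
[cite: Mochizuki2012, IUTchIII Ex 3.6 (ii) p.107] [claim: Mochizuki2012, status: disputed] -/
theorem FrakObj.nontrivial_modelPlaces (K : Type) [Field K] [NumberField K] :
    Nontrivial (FrakObj (ModelPlaces K) (fun _ => ℝ)) :=
  FrakObj.nontrivial_of_ne_zero (Γ := fun _ => ℝ)
    (Sum.inr (Classical.arbitrary (NumberField.InfinitePlace K))) 1 one_ne_zero

variable {Kf : ℤ → Type} [∀ m, Field (Kf m)] {Kc : Type} [Field Kc]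

/-- **F-2094 at the model, NEW KERNEL ANCHOR — the (ii) sentence on the `MOD`/LGP column** ([IUTchIII]
Rmk. 3.10.1 (ii), p. 150; Prop. 3.10 (iii) first display, p. 149): for ANY column of Kummer field
identifications `κ_m : K_m ⥲ K_∘`, EVERY family of Kummer bijections of model-global-Frobenioid objects that is
compatible with the log-link-induced transports IS the functorial family `frakTransport (κ_m)`
(`prop310iii_model`) followed by EXACTLY ONE permutation of the coric object, the same for all `m` —
existence (Prop. 3.10 (iii)) and uniqueness up to the identity indeterminacy: "such Kummer-detachment
indeterminacies do not arise". [cite: Mochizuki2012, IUTchIII Rmk 3.10.1 (ii) p.150]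
[claim: Mochizuki2012, status: disputed] -/
theorem remark3101ii_MOD_kummer_torsor (κ : ∀ m, Kf m ≃+* Kc)
    {kum' : ∀ m, FrakObj (ModelPlaces (Kf m)) (fun _ => ℝ) ≃ FrakObj (ModelPlaces Kc) (fun _ => ℝ)}
    (hk' : Prop310iii_compatible (fun m => FrakObj (ModelPlaces (Kf m)) (fun _ => ℝ)) kum'
      (fun m => ⇑(frakTransport ((κ m).trans (κ (m + 1)).symm)))) :
    ∃! σ : Equiv.Perm (FrakObj (ModelPlaces Kc) (fun _ => ℝ)),
      ∀ m, kum' m = (frakTransport (κ m)).trans σ :=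
  existsUnique_perm_of_compatible (prop310iii_model κ) hk'

/-- **F-2096 at the model, `MOD`/LGP column — the typed predicate FAILS** ([IUTchIII] Rmk. 3.10.1 (ii),
p. 150, locates "Kummer-detachment indeterminacies do not arise" HERE): a compatible Kummer family exists
(`prop310iii_model`) and the coric object `FrakObj (ModelPlaces K_∘)` has two distinct objects, so "any two
compatible families are equal" is false. [cite: Mochizuki2012, IUTchIII Rmk 3.10.1 (ii) p.150]
[claim: Mochizuki2012, status: disputed] -/
theorem not_remark3101ii_noKDI_MOD [NumberField Kc] (κ : ∀ m, Kf m ≃+* Kc) :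
    ¬ Remark3101ii_noKummerDetachmentIndeterminacy (C := FrakObj (ModelPlaces Kc) (fun _ => ℝ))
        (fun m => FrakObj (ModelPlaces (Kf m)) (fun _ => ℝ))
        (fun m => ⇑(frakTransport ((κ m).trans (κ (m + 1)).symm))) :=
  haveI := FrakObj.nontrivial_modelPlaces Kc
  not_Remark3101ii_noKummerDetachmentIndeterminacy_of_compatible (prop310iii_model κ)

variable (F : Type) [Field F] [NumberField F] {A : Type}

/-- **F-2096 at the model, `𝔪𝔬𝔡`/lgp column — the typed predicate HOLDS, vacuously** ([IUTchIII]
Rmk. 3.10.1 (i)/(ii), p. 149–150: on THIS side print says compatible isomorphisms CANNOT be constructed):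
for the global `𝔪𝔬𝔡` column of abc-iut-w4-d002's `…Remark3101ModelGlobal` (families of local regions over all
finite places of `F` under the componentwise log-image maps, any `logk_w`, `Φ_w`, `Ψ`) and EVERY coric object,
no compatible family exists (`remark3101i_noCompatibleIso_frakFamily`, p433409), hence "any two compatible
families are equal". Together with `not_remark3101ii_noKDI_MOD`: the typed F-2096 predicate is INVERTED with
respect to print at the genuine carriers. [cite: Mochizuki2012, IUTchIII Rmk 3.10.1 (ii) p.150]
[claim: Mochizuki2012, status: disputed] -/
theorem remark3101ii_noKDI_frakFamily (v : IsDedekindDomain.HeightOneSpectrum (NumberField.RingOfIntegers F))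
    (logk : ∀ w : IsDedekindDomain.HeightOneSpectrum (NumberField.RingOfIntegers F),
      Additive (↥(w.adicCompletionIntegers F))ˣ →+ w.adicCompletion F)
    (Φ : ∀ w : IsDedekindDomain.HeightOneSpectrum (NumberField.RingOfIntegers F),
      Set (w.adicCompletion F) → Set (w.adicCompletion F))
    (Ψ : A → A) (a : A) (C : Type) :
    Remark3101ii_noKummerDetachmentIndeterminacy (C := C)
      (fun _ : ℤ => (∀ w : IsDedekindDomain.HeightOneSpectrum (NumberField.RingOfIntegers F),
        Set (w.adicCompletion F)) × A)
      (fun (_ : ℤ) (Ea : (∀ w : IsDedekindDomain.HeightOneSpectrum (NumberField.RingOfIntegers F),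
          Set (w.adicCompletion F)) × A) =>
        ((fun w => Φ w ((fun x : (↥(w.adicCompletionIntegers F))ˣ => logk w (Additive.ofMul x)) ''
            {x : (↥(w.adicCompletionIntegers F))ˣ |
              ((x : ↥(w.adicCompletionIntegers F)) : w.adicCompletion F) ∈ Ea.1 w})),
          Ψ Ea.2)) :=
  Remark3101ii_noKummerDetachmentIndeterminacy_of_noCompatibleIso
    (remark3101i_noCompatibleIso_frakFamily F v logk Φ Ψ a C)

/-- **F-2097 at the GENUINE carrier, SHARP** ([IUTchIII] Rmk. 3.10.1 (iii), p. 150, with Prop. 3.9 (iii),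
p. 117): for the objects `𝔍` of `𝓕⊛_𝔪𝔬𝔡` over all places of the number field `F` (`ModelFrakObj F`, Ex. 3.6 (ii)),
`deg` = degree of the arithmetic divisor of `𝔍`, `vol` = abc-iut-L6-d3's divisor log-volume, the typed estimate
(instance of record `remark3101iii_estimate_frak`, p410376) is ATTAINED: the region of `𝔍` itself is a
region containing it whose log-volume EQUALS `deg 𝔍` — the "estimate" computes the degree exactly, the slack
in general coming only from monotonicity (`globalLogVolume_mono`).
[cite: Mochizuki2012, IUTchIII Rmk 3.10.1 (iii) p.150] [claim: Mochizuki2012, status: disputed] -/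
theorem remark3101iii_estimate_frak_sharp (J : ModelFrakObj F) :
    ∃ S, frakRegion J ⊆ S ∧ globalLogVolume (divisorLogVolume F) S = frakDeg J :=
  ⟨frakRegion J, fun _ => le_rfl, globalLogVolume_frakRegion J⟩

/-- **F-2097 at the GENUINE carrier via the characterisation**: the instance of record is exactly the
conjunction "log-volume is monotone" ∧ "log-volume of `𝔍`'s region = `deg 𝔍`" fed into
`Remark3101iii_estimate_of_vol_regionOf_eq` — recorded as the pointwise form `deg 𝔍 ≤ μ^log(region of 𝔍)`
(with equality). [cite: Mochizuki2012, IUTchIII Rmk 3.10.1 (iii) p.150] [claim: Mochizuki2012, status: disputed] -/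
theorem remark3101iii_estimate_frak_pointwise (J : ModelFrakObj F) :
    frakDeg J ≤ globalLogVolume (divisorLogVolume F) (frakRegion J) :=
  (Remark3101iii_estimate_iff_of_refl_mono (deg := frakDeg (F := F)) (regionOf := frakRegion)
      (vol := globalLogVolume (divisorLogVolume F)) (fun _ _ => le_rfl)
      (fun _ _ h => globalLogVolume_mono h)).mp remark3101iii_estimate_frak J

end Genuine

end Literature.IUT.LogThetaLattice

end
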